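import Summits.KontsevichZagierPeriods.KontsevichZagierPeriods.Theorems.RootDecompRationalCubeDichotomyRankDescentP10

/-! # `RootDecompRationalCubeDichotomyRankDescentP11` — part 11/14 of the mechanical ≤400-line split of `RankDescent_v12_landing.lean` (sha256 00885b8b9882f02e…)
Source: decomp-kz lens-2 g13 `RankDescent_v12.lean` (HOME/decomp-kz-lens-2/g13/, sha256 00885b8b…; critic g5-18…g5-66 CLEARED as NODE v1–v12 for crux stmt-KontsevichZagierPeriods-26322 RationalCubePiKernelSingle: rank dichotomy single_of_fullRankGeTwo + RankLeOneKernel, de Rham-exact descent, linear-in-one-variable / hyperbola / Fermat–hyperbolic / conic classes, transport kit, Brieskorn module; writer g7 l.1222: «landing split §0–4 ∣ … ∣ §16 --supports 26322 endorsed»); `#print axioms` pins removed; landed by census-1 g9.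
Split by census-1 g9 `gen/splitlean.py`: scopes re-opened with their `open`/`variable`/`set_option` context; mathematics and declaration order unchanged. -/

noncomputable section
open MeasureTheory Set MvPolynomial
open Literature.NumberTheory.Transcendental
open Literature.NumberTheory.Transcendental.KZ
namespace Summit.KontsevichZagierPeriods.RootDecompRationalCubeDichotomy.Rung26322.RankDescent
variable {M : ℕ}

open MeasureTheory Set MvPolynomial in
open Literature.NumberTheory.Transcendental in
open Literature.NumberTheory.Transcendental.KZ in
/-- `∂_k`-antiderivatives exist in `ℚ[x]`. [folklore] -/
private theorem exists_pderiv_eq (k : Fin M) (P : MvPolynomial (Fin M) ℚ) :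
    ∃ G : MvPolynomial (Fin M) ℚ, pderiv k G = P := by
  have hv : (Pi.single k (1:ℚ) : Fin M → ℚ) ≠ 0 := by
    intro h
    have := congrFun h k
    simp at this
  obtain ⟨G, hG⟩ := exists_dirD_eq (Pi.single k (1:ℚ)) hv P
  refine ⟨G, ?_⟩
  have hs : (∑ j, (Pi.single k (1:ℚ) : Fin M → ℚ) j • (pderiv j G : MvPolynomial (Fin M) ℚ)) = pderiv k G := by
    rw [Finset.sum_eq_single k (fun j _ hj => by simp [hj])
      (fun h => (h (Finset.mem_univ k)).elim)]
    simp
  rw [dirD_apply, hs] at hG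
  exact hG

/-- **Numerators with vanishing norm-form functional are exact over `a₀ + u² − D v²`** (`D ≠ 0`). [folklore] -/
theorem drExact_normConic (a₀ D : ℚ) (hD : D ≠ 0) (P : MvPolynomial (Fin 2) ℚ) (h : normAlt a₀ D P = 0) :
    DRExact P (C a₀ + X 0 ^ 2 - C D * X 1 ^ 2) := by
  have := sub_C_normAlt_mem a₀ D hD P
  rw [h, map_zero, sub_zero] at this
  exact drExact_of_ex0 this

/-- **GENERAL RANK-2 CONICS `Q = a₀ + L₁² − D·L₂²`** (`L₁ = ax + by + e`, `L₂ = cx + dy + e'` independent, `D ≠ 0`): functional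
`P ↦ normAlt a₀ D (σ⁻¹P)`; zero ⟹ exact. [folklore] -/
theorem drExact_conic (a₀ D : ℚ) (hD : D ≠ 0) (a b e c d e' : ℚ) (hΔ : a * d - b * c ≠ 0) (P : MvPolynomial (Fin 2) ℚ)
    (h : normAlt a₀ D (aeval (affInv a b e c d e') P) = 0) :
    DRExact P (C a₀ + affMap a b e c d e' 0 ^ 2 - C D * affMap a b e c d e' 1 ^ 2) := by
  have h' : normAlt a₀ D (C (a * d - b * c)⁻¹ * aeval (affInv a b e c d e') P) = 0 := by
    rw [normAlt_C_mul, h, mul_zero]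
  have h1 := drExact_normConic a₀ D hD _ h'
  have h2 := drExact_affine a b e c d e' h1
  rw [eq_aff_unaff a b e c d e' hΔ] at h2
  have hQ : aeval (affMap a b e c d e') (C a₀ + X 0 ^ 2 - C D * X 1 ^ 2 : MvPolynomial (Fin 2) ℚ)
      = C a₀ + affMap a b e c d e' 0 ^ 2 - C D * affMap a b e c d e' 1 ^ 2 := by
    rw [map_sub, map_add, map_mul, map_pow, map_pow, aeval_X, aeval_X, MvPolynomial.aeval_C, MvPolynomial.aeval_C,
      MvPolynomial.algebraMap_eq]
  rwa [hQ] at h2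

/-- **DECIDED (m = 2, PROVED, N = 0): every rank-2 conic `k·(a₀ + L₁² − D L₂²)`, functional zero** — including the conics with NO
rational point at infinity (`x² + y² + 1`, Serret's `(x+y)² + (x−1)²`, `x² + xy + y² + …`, `x² − 2y² + …`). [cite: KontsevichZagier2001, §1.2] -/
theorem conic_two_mem_relations (k : ℚ) (hk : k ≠ 0) (a₀ D : ℚ) (hD : D ≠ 0) (a b e c d e' : ℚ)
    (hΔ : a * d - b * c ≠ 0) (q : IntegralRep 2) (P : MvPolynomial (Fin 2) ℚ)
    (hP : normAlt a₀ D (aeval (affInv a b e c d e') (C k⁻¹ * P)) = 0)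
    (hd : q.domain = Set.pi Set.univ (fun _ : Fin 2 => Set.Icc (0:ℝ) 1))
    (hQ : ∀ z ∈ Set.pi Set.univ (fun _ : Fin 2 => Set.Icc (0:ℝ) 1),
      MvPolynomial.aeval z (C k * (C a₀ + affMap a b e c d e' 0 ^ 2 - C D * affMap a b e c d e' 1 ^ 2)) ≠ 0)
    (hf : ∀ z ∈ Set.pi Set.univ (fun _ : Fin 2 => Set.Icc (0:ℝ) 1),
      q.integrand z = MvPolynomial.aeval z P
        / MvPolynomial.aeval z (C k * (C a₀ + affMap a b e c d e' 0 ^ 2 - C D * affMap a b e c d e' 1 ^ 2)))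
    (h0 : q.value = 0) : of q ∈ relations := by
  have hf' := integrand_rescale k hk hf
  have hQ' := zeroFree_rescale k hk hQ
  have hcc : C k⁻¹ * (C k * (C a₀ + affMap a b e c d e' 0 ^ 2 - C D * affMap a b e c d e' 1 ^ 2))
      = C a₀ + affMap a b e c d e' 0 ^ 2 - C D * affMap a b e c d e' 1 ^ 2 := by
    rw [← mul_assoc, ← map_mul, inv_mul_cancel₀ hk, map_one, one_mul]
  rw [hcc] at hf' hQ'
  obtain ⟨s, G, hid⟩ := drExact_conic a₀ D hD a b e c d e' hΔ _ hP
  exact mem_relations_of_exact_two q _ _ s G hid hd hQ' hf' h0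

/-- Residual of the conic class: norm-form functional NON-ZERO (one rational parameter per conic). [folklore] -/
def ConicResidual (k a₀ D a b e c d e' : ℚ) : Prop :=
  ∀ (q : IntegralRep 2) (P : MvPolynomial (Fin 2) ℚ),
    normAlt a₀ D (aeval (affInv a b e c d e') (C k⁻¹ * P)) ≠ 0 →
    q.domain = Set.pi Set.univ (fun _ : Fin 2 => Set.Icc (0:ℝ) 1) →
    (∀ z ∈ Set.pi Set.univ (fun _ : Fin 2 => Set.Icc (0:ℝ) 1),
      MvPolynomial.aeval z (C k * (C a₀ + affMap a b e c d e' 0 ^ 2 - C D * affMap a b e c d e' 1 ^ 2)) ≠ 0) →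
    (∀ z ∈ Set.pi Set.univ (fun _ : Fin 2 => Set.Icc (0:ℝ) 1),
      q.integrand z = MvPolynomial.aeval z P
        / MvPolynomial.aeval z (C k * (C a₀ + affMap a b e c d e' 0 ^ 2 - C D * affMap a b e c d e' 1 ^ 2))) →
    q.value = 0 → ∃ N : ℕ, (fun y : FormalRep => of piRep * y)^[N] (of q) ∈ relations

/-- **26322 on a rank-2 conic ⟸ its one-parameter residual (PROVED split).** [folklore] -/
theorem conic_single_of_residual (k : ℚ) (hk : k ≠ 0) (a₀ D : ℚ) (hD : D ≠ 0) (a b e c d e' : ℚ)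
    (hΔ : a * d - b * c ≠ 0) (h : ConicResidual k a₀ D a b e c d e') (q : IntegralRep 2) (P : MvPolynomial (Fin 2) ℚ)
    (hd : q.domain = Set.pi Set.univ (fun _ : Fin 2 => Set.Icc (0:ℝ) 1))
    (hQ : ∀ z ∈ Set.pi Set.univ (fun _ : Fin 2 => Set.Icc (0:ℝ) 1),
      MvPolynomial.aeval z (C k * (C a₀ + affMap a b e c d e' 0 ^ 2 - C D * affMap a b e c d e' 1 ^ 2)) ≠ 0)
    (hf : ∀ z ∈ Set.pi Set.univ (fun _ : Fin 2 => Set.Icc (0:ℝ) 1),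
      q.integrand z = MvPolynomial.aeval z P
        / MvPolynomial.aeval z (C k * (C a₀ + affMap a b e c d e' 0 ^ 2 - C D * affMap a b e c d e' 1 ^ 2)))
    (h0 : q.value = 0) : ∃ N : ℕ, (fun y : FormalRep => of piRep * y)^[N] (of q) ∈ relations := by
  by_cases hP : normAlt a₀ D (aeval (affInv a b e c d e') (C k⁻¹ * P)) = 0
  · exact ⟨0, by simpa using conic_two_mem_relations k hk a₀ D hD a b e c d e' hΔ q P hP hd hQ hf h0⟩
  · exact h q P hP hd hQ hf h0

/-! ### §13b Census instances (kernel-checked functional values) -/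

/-- Serret's denominator is a norm-form conic: `(x + y)² + (x − 1)² = 1 − 2x + 2x² + 2xy + y²` (`a₀ = 0`, `D = −1`, `σ = (x + y, x − 1)`, `Δ = −1`). [folklore] -/
example : (C 0 + affMap 1 1 0 1 0 (-1) 0 ^ 2 - C (-1) * affMap 1 1 0 1 0 (-1) 1 ^ 2 : MvPolynomial (Fin 2) ℚ)
    = 1 - 2 * X 0 + 2 * X 0 ^ 2 + 2 * X 0 * X 1 + X 1 ^ 2 := by
  simp [affMap]
  ring

/-- On Serret's `Q`: the numerator `x + y` has functional `0` (`σ⁻¹(x + y) = u`, `upow 1 = 0`) — `(x+y)/(1 − 2x + 2x² + 2xy + y²)` is exact,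
26322 DECIDED there (N = 0). [folklore] -/
example : normAlt 0 (-1) (aeval (affInv 1 1 0 1 0 (-1)) (C (1:ℚ)⁻¹ * (X 0 + X 1 : MvPolynomial (Fin 2) ℚ))) = 0 := by
  have h : aeval (affInv 1 1 0 1 0 (-1)) (C (1:ℚ)⁻¹ * (X 0 + X 1 : MvPolynomial (Fin 2) ℚ)) = X 0 := by
    simp [affInv]
    ring
  rw [h, normAlt_X]

/-- … while `1 ↦ 1` (the `π·log 2`-type generator `∫∫ dxdy/((x+y)² + (x−1)²)`). [folklore] -/
example : normAlt 0 (-1) (aeval (affInv 1 1 0 1 0 (-1)) (C (1:ℚ)⁻¹ * (1 : MvPolynomial (Fin 2) ℚ))) = 1 := by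
  rw [inv_one, C_1, one_mul, map_one, ← C_1, normAlt_C]

/-- On `1 + x² + y²` (`a₀ = 1`, `D = −1`, `σ = id`): `x² − y² ↦ upow 2 − lam 0 2 = −1/2 − (−1/2) = 0` — `(x² − y²)/(1 + x² + y²)` is exact (decided);
`x² + y² ↦ −1` (it is `Q − 1`). [folklore] -/
example : normAlt 1 (-1) (X 0 ^ 2 - X 1 ^ 2 : MvPolynomial (Fin 2) ℚ) = 0 := by
  rw [normAlt_sub, normAlt_X0_pow, normAlt_X1_pow, upow_succ_succ, upow_zero, lam_succ_succ, lam_zero, upow_succ_succ,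
    upow_zero]
  norm_num

example : normAlt 1 (-1) (X 0 ^ 2 + X 1 ^ 2 : MvPolynomial (Fin 2) ℚ) = -1 := by
  rw [normAlt_add, normAlt_X0_pow, normAlt_X1_pow, upow_succ_succ, upow_zero, lam_succ_succ, lam_zero, upow_succ_succ,
    upow_zero]
  norm_num

/-! ## §14 (v10) THE CODIMENSION-ONE THEOREM FOR ALL DENOMINATORS OF DEGREE ≤ 2 (uniform, one Lean statement)

`CodimOne Q :⟺ ∃ Λ : ℚ[x,y] →ₗ[ℚ] ℚ, ∀ P, DRExact (P − Λ(P)·1) Q` — every numerator is de Rham-congruent over `Q` to a rational multiple of `1`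
(so the exact numerators have codimension ≤ 1 and `Λ P = 0 ⟹ P/Q exact`, constructively). It is stable under `Q ↦ k·Q` (`drExact_C_mul`,
`codimOne_C_mul`) and under `AGL₂(ℚ)` (`codimOne_affine`, functional `Λ ∘ σ⁻¹`); the base forms of §6 (`codimOne_monicLinear`, Λ = 0), §8
(`codimOne_hyp`, Λ = `diagAlt`), §12 (`codimOne_affineGraph`, Λ = 0), §13 (`codimOne_norm`, Λ = `normAlt`) and the cylinders (`drExact_of_pderiv_eq_zero`,
Λ = 0) then give, by completing the square (the case tree of ADD.8's table, carried out in `ℚ`):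
**`codimOne_degTwo : ∀ α β γ δ ε ζ, CodimOne (ζ + δx + εy + αx² + βxy + γy²)`** — and, for the route, **`degTwo_two_mem_relations`**: on EVERY denominator of
total degree ≤ 2, `[ [0,1]², P/Q ]` zero-free with value `0` and `Λ_Q P = 0` lies in `relations` (N = 0), with the PROVED split `degTwo_single_of_residual`
(26322 on such a `Q` ⟸ the ONE-parameter residual `Λ_Q P ≠ 0`). This is the census box in one theorem. -/

/-- Codimension-one property of a denominator: every numerator is de Rham-congruent to a rational constant. [folklore] -/
def CodimOne (Q : MvPolynomial (Fin 2) ℚ) : Prop :=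
  ∃ Λ : MvPolynomial (Fin 2) ℚ →ₗ[ℚ] ℚ, ∀ P, DRExact (P - C (Λ P)) Q

/-- Auxiliary step `codimOne_of_all` (§14): codim One of all. [bookkeeping] -/
theorem codimOne_of_all {Q : MvPolynomial (Fin 2) ℚ} (h : ∀ P, DRExact P Q) : CodimOne Q :=
  ⟨0, fun P => by simpa using h P⟩

/-- Scaling the denominator by a constant keeps exactness (potentials `k^s·G`). [folklore] -/
theorem drExact_C_mul {m : ℕ} (k : ℚ) {P Q : MvPolynomial (Fin m) ℚ} (h : DRExact P Q) : DRExact P (C k * Q) := by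
  obtain ⟨s, G, hG⟩ := h
  refine ⟨s, fun i => C (k ^ s) * G i, ?_⟩
  have hk : P * (C k * Q) ^ (s + 1) = C k ^ (s + 1) * (P * Q ^ (s + 1)) := by ring
  rw [hk, hG, Finset.mul_sum]
  refine Finset.sum_congr rfl fun i _ => ?_
  simp only [Derivation.leibniz, pderiv_C, smul_eq_mul]
  simp only [map_pow]
  ring

/-- Auxiliary step `codimOne_C_mul` (§14): codim One C mul. [bookkeeping] -/
theorem codimOne_C_mul (k : ℚ) {Q : MvPolynomial (Fin 2) ℚ} (h : CodimOne Q) : CodimOne (C k * Q) := by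
  obtain ⟨Λ, hΛ⟩ := h
  exact ⟨Λ, fun P => drExact_C_mul k (hΛ P)⟩

/-- `CodimOne` is `AGL₂(ℚ)`-invariant: functional `Λ ∘ σ⁻¹`. [folklore] -/
theorem codimOne_affine (a b e c d e' : ℚ) (hΔ : a * d - b * c ≠ 0) {Q : MvPolynomial (Fin 2) ℚ} (h : CodimOne Q) :
    CodimOne (aeval (affMap a b e c d e') Q) := by
  obtain ⟨Λ, hΛ⟩ := h
  refine ⟨Λ ∘ₗ (aeval (affInv a b e c d e')).toLinearMap, fun P => ?_⟩
  have h1 := hΛ (C (a * d - b * c)⁻¹ * aeval (affInv a b e c d e') P)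
  have h2 := drExact_affine a b e c d e' h1
  have hr : Λ (C (a * d - b * c)⁻¹ * aeval (affInv a b e c d e') P) * (a * d - b * c)
      = Λ (aeval (affInv a b e c d e') P) := by
    rw [← smul_eq_C_mul, LinearMap.map_smul, smul_eq_mul]
    field_simp
  rw [map_sub, sub_mul, eq_aff_unaff a b e c d e' hΔ P, MvPolynomial.aeval_C, MvPolynomial.algebraMap_eq, ← map_mul,
    hr] at h2
  rw [LinearMap.comp_apply, AlgHom.toLinearMap_apply]
  exact h2

/-- Cylinders: if `Q` does not involve `x_k`, EVERY `P/Q` is exact (`s = 0`, potential `∂_k⁻¹P` in slot `k`). [folklore] -/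
theorem drExact_of_pderiv_eq_zero (k : Fin 2) {Q : MvPolynomial (Fin 2) ℚ} (hQ : pderiv k Q = 0)
    (P : MvPolynomial (Fin 2) ℚ) : DRExact P Q := by
  obtain ⟨F, hF⟩ := exists_pderiv_eq k P
  refine ⟨0, (Pi.single k F : Fin 2 → MvPolynomial (Fin 2) ℚ), ?_⟩
  rw [sum_exS_eq, sum_exS_single, zero_add, pow_one, exS, hF, hQ, mul_zero, mul_zero, sub_zero]

/-- Auxiliary step `codimOne_monicLinear` (§14): codim One monic Linear. [bookkeeping] -/
theorem codimOne_monicLinear (A₀ : MvPolynomial (Fin 1) ℚ) :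
    CodimOne (X 0 + rename Fin.succ A₀ : MvPolynomial (Fin 2) ℚ) :=
  codimOne_of_all (drExact_of_monicLinear (0 : Fin 1) A₀)

/-- Auxiliary step `codimOne_affineGraph` (§14): codim One affine Graph. [bookkeeping] -/
theorem codimOne_affineGraph (a b e c d e' : ℚ) (hΔ : a * d - b * c ≠ 0) (A₀ : MvPolynomial (Fin 1) ℚ) :
    CodimOne (affMap a b e c d e' 0 + evalAt A₀ (affMap a b e c d e' 1)) :=
  codimOne_of_all (drExact_affineGraph a b e c d e' hΔ A₀)

/-- `diagAlt` as a linear functional. [folklore] -/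
def diagAltL (q₀ : ℚ) : MvPolynomial (Fin 2) ℚ →ₗ[ℚ] ℚ where
  toFun := diagAlt q₀
  map_add' := diagAlt_add q₀
  map_smul' c P := by simp only [diagAlt_smul, RingHom.id_apply, smul_eq_mul]

/-- `normAlt` as a linear functional. [folklore] -/
def normAltL (a₀ D : ℚ) : MvPolynomial (Fin 2) ℚ →ₗ[ℚ] ℚ where
  toFun := normAlt a₀ D
  map_add' := normAlt_add a₀ D
  map_smul' c P := by simp only [normAlt_smul, RingHom.id_apply, smul_eq_mul]

/-- Auxiliary step `codimOne_hyp` (§14): codim One hyp. [bookkeeping] -/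
theorem codimOne_hyp (q₀ : ℚ) : CodimOne (hypQ q₀) :=
  ⟨diagAltL q₀, fun P => drExact_of_ex0 (sub_C_diagAlt_mem q₀ P)⟩

/-- Auxiliary step `codimOne_norm` (§14): codim One norm. [bookkeeping] -/
theorem codimOne_norm (a₀ D : ℚ) (hD : D ≠ 0) : CodimOne (normQ a₀ D) :=
  ⟨normAltL a₀ D, fun P => drExact_of_ex0 (sub_C_normAlt_mem a₀ D hD P)⟩

/-- The general polynomial of total degree ≤ 2. [folklore] -/
def conicQ (α β γ δ ε ζ : ℚ) : MvPolynomial (Fin 2) ℚ :=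
  C ζ + C δ * X 0 + C ε * X 1 + C α * X 0 ^ 2 + C β * (X 0 * X 1) + C γ * X 1 ^ 2

/-- Completing the square, leading case `α ≠ 0`. [folklore] -/
theorem codimOne_degTwo_of_ne_zero (α β γ δ ε ζ : ℚ) (hα : α ≠ 0) : CodimOne (conicQ α β γ δ ε ζ) := by
  set b := β / (2 * α) with hb
  set D := (β ^ 2 - 4 * α * γ) / (4 * α ^ 2) with hDdef
  set e := δ / (2 * α) with he
  have t1 : α * (2 * b) = β := by rw [hb]; field_simp
  have t2 : α * (b ^ 2 - D) = γ := by rw [hb, hDdef]; field_simp; ring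
  have t3 : α * (2 * e) = δ := by rw [he]; field_simp
  have t1' : (C α * (2 * C b) : MvPolynomial (Fin 2) ℚ) = C β := by
    rw [← map_ofNat C 2, ← map_mul, ← map_mul, t1]
  have t2' : (C α * (C b ^ 2 - C D) : MvPolynomial (Fin 2) ℚ) = C γ := by
    rw [← map_pow, ← map_sub, ← map_mul, t2]
  have t3' : (C α * (2 * C e) : MvPolynomial (Fin 2) ℚ) = C δ := by
    rw [← map_ofNat C 2, ← map_mul, ← map_mul, t3]
  by_cases hD : D = 0
  · -- rank-1 quadratic part `α (x + b y)²`
    by_cases hpar : ε - b * δ = 0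
    · -- cylinder `g(x + b y)`
      have t4 : δ * b = ε := by linear_combination -hpar
      have t4' : (C δ * C b : MvPolynomial (Fin 2) ℚ) = C ε := by rw [← map_mul, t4]
      have hQ : conicQ α β γ δ ε ζ
          = aeval (affMap 1 b 0 0 1 0) (C α * X 0 ^ 2 + C δ * X 0 + C ζ : MvPolynomial (Fin 2) ℚ) := by
        simp only [conicQ, affMap, map_add, map_mul, map_pow, aeval_X, MvPolynomial.aeval_C, MvPolynomial.algebraMap_eq,
          Matrix.cons_val_zero, map_one, map_zero, one_mul, zero_mul, add_zero, zero_add]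
        rw [hD, map_zero, sub_zero] at t2'
        linear_combination (-(X 0 * X 1)) * t1' - X 1 ^ 2 * t2' - X 1 * t4'
      rw [hQ]
      refine codimOne_affine 1 b 0 0 1 0 (by norm_num) (codimOne_of_all (drExact_of_pderiv_eq_zero 1 ?_))
      simp
    · -- affine graph `L₁ + L₂²`, `L₂ = x + b y`, `L₁ = (δ x + ε y + ζ)/α`
      have u3 : α * (δ / α) = δ := by field_simp
      have u4 : α * (ε / α) = ε := by field_simp
      have u5 : α * (ζ / α) = ζ := by field_simp
      have u3' : (C α * C (δ / α) : MvPolynomial (Fin 2) ℚ) = C δ := by rw [← map_mul, u3]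
      have u4' : (C α * C (ε / α) : MvPolynomial (Fin 2) ℚ) = C ε := by rw [← map_mul, u4]
      have u5' : (C α * C (ζ / α) : MvPolynomial (Fin 2) ℚ) = C ζ := by rw [← map_mul, u5]
      have hΔ : δ / α * b - ε / α * 1 ≠ 0 := by
        intro h0
        apply hpar
        have : (δ / α * b - ε / α * 1) * α = -(ε - b * δ) := by field_simp; ring
        rw [h0, zero_mul] at this
        linear_combination this
      have hQ : conicQ α β γ δ ε ζ
          = C α * (affMap (δ / α) (ε / α) (ζ / α) 1 b 0 0 + evalAt (X 0 ^ 2) (affMap (δ / α) (ε / α) (ζ / α) 1 b 0 1)) := by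
        simp only [conicQ, affMap, evalAt, map_pow, aeval_X, Matrix.cons_val_zero, Matrix.cons_val_one, map_one, map_zero,
          one_mul, add_zero]
        rw [hD, map_zero, sub_zero] at t2'
        linear_combination (-1 : MvPolynomial (Fin 2) ℚ) * u5' - X 0 * u3' - X 1 * u4' - (X 0 * X 1) * t1' - X 1 ^ 2 * t2'
      rw [hQ]
      exact codimOne_C_mul α (codimOne_affineGraph _ _ _ _ _ _ hΔ _)
  · -- rank-2 quadratic part: norm form `a₀ + u² − D v²`
    set e' := (2 * α * b * e - ε) / (2 * α * D) with he'
    set a₀ := ζ / α - e ^ 2 + D * e' ^ 2 with ha₀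
    have t4 : α * (2 * (b * e - D * e')) = ε := by rw [he']; field_simp; ring
    have t5 : α * (a₀ + e ^ 2 - D * e' ^ 2) = ζ := by rw [ha₀]; field_simp; ring
    have t4' : (C α * (2 * (C b * C e - C D * C e')) : MvPolynomial (Fin 2) ℚ) = C ε := by
      rw [← map_mul, ← map_mul, ← map_sub, ← map_ofNat C 2, ← map_mul, ← map_mul, t4]
    have t5' : (C α * (C a₀ + C e ^ 2 - C D * C e' ^ 2) : MvPolynomial (Fin 2) ℚ) = C ζ := by
      rw [← map_pow, ← map_pow, ← map_mul, ← map_add, ← map_sub, ← map_mul, t5]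
    have hQ : conicQ α β γ δ ε ζ = C α * aeval (affMap 1 b e 0 1 e') (normQ a₀ D) := by
      simp only [conicQ, normQ, affMap, map_add, map_sub, map_mul, map_pow, aeval_X, MvPolynomial.aeval_C,
        MvPolynomial.algebraMap_eq, Matrix.cons_val_zero, Matrix.cons_val_one, map_one, map_zero, one_mul, zero_mul,
        zero_add]
      linear_combination (-1 : MvPolynomial (Fin 2) ℚ) * t5' - X 0 * t3' - X 1 * t4' - (X 0 * X 1) * t1' - X 1 ^ 2 * t2'
    rw [hQ]
    exact codimOne_C_mul α (codimOne_affine 1 b e 0 1 e' (by norm_num) (codimOne_norm a₀ D hD))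

end Summit.KontsevichZagierPeriods.RootDecompRationalCubeDichotomy.Rung26322.RankDescent
end
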